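import Mathlib

/-!
# Hodge-locus census — THEOREM J2∞ bookkeeping: the ARITHMETIC LEMMA (admissibility of the pieces) for all `k′ ≥ 4`, `d ≥ 4`

certified instances and evidence bearing on the general Hodge conjecture; no claim.

pub-hlocus ENGINE B (seat ivhs-2), gen 33, record `pub-hlocus-ivhs-2/ENGINEB-g33.md` §4d (def-free, notation-free helper of
`stmt-HodgeConjecture-16267`; companion of `HodgeLocusCensusJumpStratum.lean`, `…JumpFlag.lean`, `…JumpFamilies.lean`).

Setting (record §4b/§4d).  In the c′ = 1 cell `(2k′, d, k′-1)` the pieces of the jump locus `{b ≥ 1} ∩ U_ci` have codimensions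
`E+1` (`Σ°`), `C(k′+d-3, d-2)` (`TOP`), `E + BASE_Q(m) + φ` (`Q_r`), `E + BASE_G(m) + φ` (`G_r`), `m = k′ - r`, where
  `BASE_Q(m) = m² + C(m+1, 2) - C(m+d-1, d)`,  `BASE_G(m) = m² + C(m+d-3, d-2) - C(m+d-1, d)`,
  `E + 1 = C(k′+d-1, d) - C(k′+1, 2) - k′² + 1`,  `φ = 1` except `φ_P = k′` (`P = Q_1`) and `φ_{G_2} = 2` at `d = 4`;
a piece can be a component only if it is ADMISSIBLE: its codimension is `≤ E+1` (J1(a)).  THEOREM J2∞ needs, for ALL `k′ ≥ 4`,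
`d ≥ 4`, the admissibility table of the ARITHMETIC LEMMA (a); the cases `m ≤ 3` are in `…JumpFlag.lean`, the step identities and their
signs in `…JumpFamilies.lean`; this file closes the table for every `m` (parameters: `m = p + 3` or as stated, `d = e + 4`, `k′ = p + 4`).

KERNEL-CHECKED HERE (all parameters; integer arithmetic of binomials only — Pascal's rule, `Nat.choose_symm_add`, `Nat.choose_mono`, induction):
* `baseQ_nonpos`, `baseG_nonpos` : `BASE_Q(m) ≤ 0` and `BASE_G(m) ≤ 0` for all `m ≥ 3`, `d ≥ 4` — so `Q_r`, `G_r` with `m = k′-r ≥ 3` (`φ = 1`) and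
  `P′` (`m = k′-1 ≥ 3`, `φ = 1`, G-branch) are admissible in every cell;
* `baseG_ge_baseQ` : `C(m+d-3, d-2) ≥ C(m+1, 2)`, i.e. `BASE_G(m) ≥ BASE_Q(m)` (`m ≥ 1`); `baseQ_pred_gt_baseG` : `BASE_Q(m-1) > BASE_G(m)` (`m ≥ 3`);
* `top_admissible` : `C(k′+d-3, d-2) ≤ E+1` for all `k′ ≥ 4`, `d ≥ 4` (tight exactly at `(4,4)`: `top_tight_44`);
* `P_admissible_iff` : `BASE_Q(k′-1) + k′ ≤ 1 ↔ (k′, d) ≠ (4, 4)` (`k′ ≥ 4`, `d ≥ 4`);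
* `G2_d4_admissible_iff` : at `d = 4`, `BASE_G(k′-2) + 2 ≤ 1 ↔ k′ ≥ 6` (`k′ ≥ 4`).
NOT kernel-checked: the orderings (b) beyond the box of `…JumpFamilies.orderings_box`, and all geometry.
-/

namespace Summit.HodgeConjecture.HodgeConjecture.HodgeLocus.Census.JumpArithmetic

/-- `BASE_Q(m) ≤ 0` for `m = p + 3 ≥ 3`, `d = e + 4 ≥ 4`: `(p+3)² + C(p+4, 2) ≤ C(p+e+6, e+4)` (equality at `p = e = 0`). -/
theorem baseQ_nonpos (p e : ℕ) :
    ((p : ℤ) + 3) ^ 2 + ((Nat.choose (p + 4) 2 : ℕ) : ℤ) - ((Nat.choose (p + e + 6) (e + 4) : ℕ) : ℤ) ≤ 0 := by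
  -- monotonicity in d: C(p+e+6, e+4) ≥ C(p+6, 4)
  have mono : Nat.choose (p + 6) 4 ≤ Nat.choose (p + e + 6) (e + 4) := by
    have s1 : Nat.choose (p + e + 6) (e + 4) = Nat.choose ((p + 2) + (e + 4)) (p + 2) := by
      rw [show p + e + 6 = (p + 2) + (e + 4) by ring, Nat.choose_symm_add]
    have s2 : Nat.choose (p + 6) 4 = Nat.choose ((p + 2) + 4) (p + 2) := by
      rw [show p + 6 = (p + 2) + 4 by ring, Nat.choose_symm_add]
    rw [s1, s2]; exact Nat.choose_mono (p + 2) (by omega)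
  -- growth of C(p+6, 3)
  have grow3 : ∀ q : ℕ, 3 * q + 12 ≤ Nat.choose (q + 6) 3 := by
    intro q
    induction q with
    | zero => decide
    | succ q ih =>
      rw [show q + 1 + 6 = q + 7 from rfl]
      have pas : Nat.choose (q + 7) 3 = Nat.choose (q + 6) 2 + Nat.choose (q + 6) 3 := by
        rw [show q + 7 = (q + 6) + 1 by ring, Nat.choose_succ_succ]
      have m2 : Nat.choose 6 2 ≤ Nat.choose (q + 6) 2 := Nat.choose_mono 2 (by omega)
      have c62 : Nat.choose 6 2 = 15 := by decide
      omega
  -- the d = 4 inequality by induction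
  have key : ∀ q : ℕ, (q + 3) ^ 2 + Nat.choose (q + 4) 2 ≤ Nat.choose (q + 6) 4 := by
    intro q
    induction q with
    | zero => decide
    | succ q ih =>
      rw [show q + 1 + 3 = q + 4 from rfl, show q + 1 + 4 = q + 5 from rfl, show q + 1 + 6 = q + 7 from rfl]
      have pas1 : Nat.choose (q + 7) 4 = Nat.choose (q + 6) 3 + Nat.choose (q + 6) 4 := by
        rw [show q + 7 = (q + 6) + 1 by ring, Nat.choose_succ_succ]
      have pas2 : Nat.choose (q + 5) 2 = (q + 4) + Nat.choose (q + 4) 2 := by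
        rw [show q + 5 = (q + 4) + 1 by ring, Nat.choose_succ_succ, Nat.choose_one_right]
      have sq : (q + 4) ^ 2 = (q + 3) ^ 2 + 2 * q + 7 := by ring
      have g := grow3 q
      omega
  have k' : (p + 3) ^ 2 + Nat.choose (p + 4) 2 ≤ Nat.choose (p + e + 6) (e + 4) := le_trans (key p) mono
  have kz : ((p : ℤ) + 3) ^ 2 + ((Nat.choose (p + 4) 2 : ℕ) : ℤ) ≤ ((Nat.choose (p + e + 6) (e + 4) : ℕ) : ℤ) := by
    exact_mod_cast k'
  linarith

/-- `BASE_G(m) ≤ 0` for `m = p + 3 ≥ 3`, `d = e + 4 ≥ 4`: `(p+3)² + C(p+e+4, e+2) ≤ C(p+e+6, e+4)`. -/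
theorem baseG_nonpos (p e : ℕ) :
    ((p : ℤ) + 3) ^ 2 + ((Nat.choose (p + e + 4) (e + 2) : ℕ) : ℤ) - ((Nat.choose (p + e + 6) (e + 4) : ℕ) : ℤ) ≤ 0 := by
  -- Pascal twice: C(p+e+6, e+4) = C(p+e+4, e+2) + C(p+e+4, e+3) + C(p+e+5, e+4)
  have pas1 : Nat.choose (p + e + 6) (e + 4) = Nat.choose (p + e + 5) (e + 3) + Nat.choose (p + e + 5) (e + 4) := by
    rw [show p + e + 6 = (p + e + 5) + 1 by ring, show e + 4 = (e + 3) + 1 by ring, Nat.choose_succ_succ]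
  have pas2 : Nat.choose (p + e + 5) (e + 3) = Nat.choose (p + e + 4) (e + 2) + Nat.choose (p + e + 4) (e + 3) := by
    rw [show p + e + 5 = (p + e + 4) + 1 by ring, show e + 3 = (e + 2) + 1 by ring, Nat.choose_succ_succ]
  -- monotonicity in d: C(p+e+4, e+3) ≥ C(p+4, 3) and C(p+e+5, e+4) ≥ C(p+5, 4)
  have mA : Nat.choose (p + 4) 3 ≤ Nat.choose (p + e + 4) (e + 3) := by
    have sA : Nat.choose (p + e + 4) (e + 3) = Nat.choose ((p + 1) + (e + 3)) (p + 1) := by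
      rw [show p + e + 4 = (p + 1) + (e + 3) by ring, Nat.choose_symm_add]
    have sA' : Nat.choose (p + 4) 3 = Nat.choose ((p + 1) + 3) (p + 1) := by
      rw [show p + 4 = (p + 1) + 3 by ring, Nat.choose_symm_add]
    rw [sA, sA']; exact Nat.choose_mono (p + 1) (by omega)
  have mB : Nat.choose (p + 5) 4 ≤ Nat.choose (p + e + 5) (e + 4) := by
    have sB : Nat.choose (p + e + 5) (e + 4) = Nat.choose ((p + 1) + (e + 4)) (p + 1) := by
      rw [show p + e + 5 = (p + 1) + (e + 4) by ring, Nat.choose_symm_add]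
    have sB' : Nat.choose (p + 5) 4 = Nat.choose ((p + 1) + 4) (p + 1) := by
      rw [show p + 5 = (p + 1) + 4 by ring, Nat.choose_symm_add]
    rw [sB, sB']; exact Nat.choose_mono (p + 1) (by omega)
  -- growth of C(q+4, 2) and the d = 4 inequality (q+3)² ≤ C(q+4,3) + C(q+5,4), by induction
  have grow2 : ∀ q : ℕ, 2 * q + 6 ≤ Nat.choose (q + 4) 2 := by
    intro q
    induction q with
    | zero => decide
    | succ q ih =>
      rw [show q + 1 + 4 = q + 5 from rfl]
      have pas : Nat.choose (q + 5) 2 = (q + 4) + Nat.choose (q + 4) 2 := by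
        rw [show q + 5 = (q + 4) + 1 by ring, Nat.choose_succ_succ, Nat.choose_one_right]
      omega
  have key : ∀ q : ℕ, (q + 3) ^ 2 ≤ Nat.choose (q + 4) 3 + Nat.choose (q + 5) 4 := by
    intro q
    induction q with
    | zero => decide
    | succ q ih =>
      rw [show q + 1 + 3 = q + 4 from rfl, show q + 1 + 4 = q + 5 from rfl, show q + 1 + 5 = q + 6 from rfl]
      have q1 : Nat.choose (q + 5) 3 = Nat.choose (q + 4) 2 + Nat.choose (q + 4) 3 := by
        rw [show q + 5 = (q + 4) + 1 by ring, Nat.choose_succ_succ]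
      have q2 : Nat.choose (q + 6) 4 = Nat.choose (q + 5) 3 + Nat.choose (q + 5) 4 := by
        rw [show q + 6 = (q + 5) + 1 by ring, Nat.choose_succ_succ]
      have sq : (q + 4) ^ 2 = (q + 3) ^ 2 + 2 * q + 7 := by ring
      have g := grow2 q
      omega
  have k' : (p + 3) ^ 2 + Nat.choose (p + e + 4) (e + 2) ≤ Nat.choose (p + e + 6) (e + 4) := by
    have k := key p
    omega
  have kz : ((p : ℤ) + 3) ^ 2 + ((Nat.choose (p + e + 4) (e + 2) : ℕ) : ℤ) ≤ ((Nat.choose (p + e + 6) (e + 4) : ℕ) : ℤ) := by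
    exact_mod_cast k'
  linarith

/-- Branch comparison `BASE_G(m) ≥ BASE_Q(m)` for `m = p + 1 ≥ 1`, `d = e + 4`: `C(m+1, 2) ≤ C(m+d-3, d-2)`. -/
theorem baseG_ge_baseQ (p e : ℕ) :
    Nat.choose ((p + 1) + 1) 2 ≤ Nat.choose ((p + 1) + (e + 4) - 3) ((e + 4) - 2) := by
  have a : (p + 1) + (e + 4) - 3 = p + (e + 2) := by omega
  have a' : (e + 4) - 2 = e + 2 := by omega
  have s1 : Nat.choose (p + (e + 2)) (e + 2) = Nat.choose (p + (e + 2)) p := by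
    rw [Nat.choose_symm_add]
  have s2 : Nat.choose ((p + 1) + 1) 2 = Nat.choose (p + 2) p := by
    rw [show (p + 1) + 1 = p + 2 by ring, Nat.choose_symm_add]
  rw [a, a', s1, s2]
  exact Nat.choose_mono p (by omega)

/-- Cross-branch ordering `BASE_Q(m-1) > BASE_G(m)` for `m = p + 3 ≥ 3`, `d = e + 4`:
`(p+3)² + C(p+e+4, e+2) - C(p+e+6, e+4) < (p+2)² + C(p+3, 2) - C(p+e+5, e+4)`. -/
theorem baseQ_pred_gt_baseG (p e : ℕ) :
    ((p : ℤ) + 3) ^ 2 + ((Nat.choose (p + e + 4) (e + 2) : ℕ) : ℤ) - ((Nat.choose (p + e + 6) (e + 4) : ℕ) : ℤ)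
      < ((p : ℤ) + 2) ^ 2 + ((Nat.choose (p + 3) 2 : ℕ) : ℤ) - ((Nat.choose (p + e + 5) (e + 4) : ℕ) : ℤ) := by
  have pas1 : Nat.choose (p + e + 6) (e + 4) = Nat.choose (p + e + 5) (e + 3) + Nat.choose (p + e + 5) (e + 4) := by
    rw [show p + e + 6 = (p + e + 5) + 1 by ring, show e + 4 = (e + 3) + 1 by ring, Nat.choose_succ_succ]
  have pas2 : Nat.choose (p + e + 5) (e + 3) = Nat.choose (p + e + 4) (e + 2) + Nat.choose (p + e + 4) (e + 3) := by
    rw [show p + e + 5 = (p + e + 4) + 1 by ring, show e + 3 = (e + 2) + 1 by ring, Nat.choose_succ_succ]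
  have mA : Nat.choose (p + 4) 3 ≤ Nat.choose (p + e + 4) (e + 3) := by
    have sA : Nat.choose (p + e + 4) (e + 3) = Nat.choose ((p + 1) + (e + 3)) (p + 1) := by
      rw [show p + e + 4 = (p + 1) + (e + 3) by ring, Nat.choose_symm_add]
    have sA' : Nat.choose (p + 4) 3 = Nat.choose ((p + 1) + 3) (p + 1) := by
      rw [show p + 4 = (p + 1) + 3 by ring, Nat.choose_symm_add]
    rw [sA, sA']; exact Nat.choose_mono (p + 1) (by omega)
  have grow3 : ∀ q : ℕ, 2 * q + 4 ≤ Nat.choose (q + 4) 3 := by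
    intro q
    induction q with
    | zero => decide
    | succ q ih =>
      rw [show q + 1 + 4 = q + 5 from rfl]
      have pas : Nat.choose (q + 5) 3 = Nat.choose (q + 4) 2 + Nat.choose (q + 4) 3 := by
        rw [show q + 5 = (q + 4) + 1 by ring, Nat.choose_succ_succ]
      have m2 : Nat.choose 4 2 ≤ Nat.choose (q + 4) 2 := Nat.choose_mono 2 (by omega)
      have c42 : Nat.choose 4 2 = 6 := by decide
      omega
  have c3 : Nat.choose 3 2 ≤ Nat.choose (p + 3) 2 := Nat.choose_mono 2 (by omega)
  have c32 : Nat.choose 3 2 = 3 := by decide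
  have sq : (p + 3) ^ 2 = (p + 2) ^ 2 + 2 * p + 5 := by ring
  have g := grow3 p
  have k' : (p + 3) ^ 2 + Nat.choose (p + e + 4) (e + 2) + Nat.choose (p + e + 5) (e + 4) + 1
      ≤ (p + 2) ^ 2 + Nat.choose (p + 3) 2 + Nat.choose (p + e + 6) (e + 4) := by
    omega
  have kz : ((p : ℤ) + 3) ^ 2 + ((Nat.choose (p + e + 4) (e + 2) : ℕ) : ℤ) + ((Nat.choose (p + e + 5) (e + 4) : ℕ) : ℤ) + 1
      ≤ ((p : ℤ) + 2) ^ 2 + ((Nat.choose (p + 3) 2 : ℕ) : ℤ) + ((Nat.choose (p + e + 6) (e + 4) : ℕ) : ℤ) := by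
    exact_mod_cast k'
  linarith

/-- `TOP` is admissible for all `k′ = p + 4 ≥ 4`, `d = e + 4 ≥ 4`:
`C(k′+d-3, d-2) ≤ E + 1 = C(k′+d-1, d) - C(k′+1, 2) - k′² + 1`. -/
theorem top_admissible (p e : ℕ) :
    ((Nat.choose ((p + 4) + (e + 4) - 3) ((e + 4) - 2) : ℕ) : ℤ)
      ≤ ((Nat.choose ((p + 4) + (e + 4) - 1) (e + 4) : ℕ) : ℤ) - ((Nat.choose ((p + 4) + 1) 2 : ℕ) : ℤ) - ((p : ℤ) + 4) ^ 2 + 1 := by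
  have a1 : (p + 4) + (e + 4) - 3 = p + e + 5 := by omega
  have a2 : (e + 4) - 2 = e + 2 := by omega
  have a3 : (p + 4) + (e + 4) - 1 = p + e + 7 := by omega
  have a4 : (p + 4) + 1 = p + 5 := by omega
  rw [a1, a2, a3, a4]
  have pas1 : Nat.choose (p + e + 7) (e + 4) = Nat.choose (p + e + 6) (e + 3) + Nat.choose (p + e + 6) (e + 4) := by
    rw [show p + e + 7 = (p + e + 6) + 1 by ring, show e + 4 = (e + 3) + 1 by ring, Nat.choose_succ_succ]
  have pas2 : Nat.choose (p + e + 6) (e + 3) = Nat.choose (p + e + 5) (e + 2) + Nat.choose (p + e + 5) (e + 3) := by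
    rw [show p + e + 6 = (p + e + 5) + 1 by ring, show e + 3 = (e + 2) + 1 by ring, Nat.choose_succ_succ]
  -- lower bounds: C(p+e+5, e+3) ≥ C(p+5, 3), C(p+e+6, e+4) ≥ C(p+6, 4)
  have mA : Nat.choose (p + 5) 3 ≤ Nat.choose (p + e + 5) (e + 3) := by
    have sA : Nat.choose (p + e + 5) (e + 3) = Nat.choose ((p + 2) + (e + 3)) (p + 2) := by
      rw [show p + e + 5 = (p + 2) + (e + 3) by ring, Nat.choose_symm_add]
    have sA' : Nat.choose (p + 5) 3 = Nat.choose ((p + 2) + 3) (p + 2) := by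
      rw [show p + 5 = (p + 2) + 3 by ring, Nat.choose_symm_add]
    rw [sA, sA']; exact Nat.choose_mono (p + 2) (by omega)
  have mB : Nat.choose (p + 6) 4 ≤ Nat.choose (p + e + 6) (e + 4) := by
    have sB : Nat.choose (p + e + 6) (e + 4) = Nat.choose ((p + 2) + (e + 4)) (p + 2) := by
      rw [show p + e + 6 = (p + 2) + (e + 4) by ring, Nat.choose_symm_add]
    have sB' : Nat.choose (p + 6) 4 = Nat.choose ((p + 2) + 4) (p + 2) := by
      rw [show p + 6 = (p + 2) + 4 by ring, Nat.choose_symm_add]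
    rw [sB, sB']; exact Nat.choose_mono (p + 2) (by omega)
  have grow3 : ∀ q : ℕ, 3 * q + 12 ≤ Nat.choose (q + 6) 3 := by
    intro q
    induction q with
    | zero => decide
    | succ q ih =>
      rw [show q + 1 + 6 = q + 7 from rfl]
      have pas : Nat.choose (q + 7) 3 = Nat.choose (q + 6) 2 + Nat.choose (q + 6) 3 := by
        rw [show q + 7 = (q + 6) + 1 by ring, Nat.choose_succ_succ]
      have m2 : Nat.choose 6 2 ≤ Nat.choose (q + 6) 2 := Nat.choose_mono 2 (by omega)
      have c62 : Nat.choose 6 2 = 15 := by decide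
      omega
  -- d = 4 inequality: C(q+5,2) + (q+4)² ≤ C(q+5,3) + C(q+6,4) + 1, by induction
  have key : ∀ q : ℕ, Nat.choose (q + 5) 2 + (q + 4) ^ 2 ≤ Nat.choose (q + 5) 3 + Nat.choose (q + 6) 4 + 1 := by
    intro q
    induction q with
    | zero => decide
    | succ q ih =>
      rw [show q + 1 + 4 = q + 5 from rfl, show q + 1 + 5 = q + 6 from rfl, show q + 1 + 6 = q + 7 from rfl]
      have q1 : Nat.choose (q + 6) 2 = (q + 5) + Nat.choose (q + 5) 2 := by
        rw [show q + 6 = (q + 5) + 1 by ring, Nat.choose_succ_succ, Nat.choose_one_right]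
      have q2 : Nat.choose (q + 6) 3 = Nat.choose (q + 5) 2 + Nat.choose (q + 5) 3 := by
        rw [show q + 6 = (q + 5) + 1 by ring, Nat.choose_succ_succ]
      have q3 : Nat.choose (q + 7) 4 = Nat.choose (q + 6) 3 + Nat.choose (q + 6) 4 := by
        rw [show q + 7 = (q + 6) + 1 by ring, Nat.choose_succ_succ]
      have sq : (q + 5) ^ 2 = (q + 4) ^ 2 + 2 * q + 9 := by ring
      have c5 : Nat.choose 5 2 ≤ Nat.choose (q + 5) 2 := Nat.choose_mono 2 (by omega)
      have c52 : Nat.choose 5 2 = 10 := by decide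
      have g := grow3 q
      omega
  have k' : Nat.choose (p + e + 5) (e + 2) + Nat.choose (p + 5) 2 + (p + 4) ^ 2 ≤ Nat.choose (p + e + 7) (e + 4) + 1 := by
    have k := key p
    omega
  have kz : ((Nat.choose (p + e + 5) (e + 2) : ℕ) : ℤ) + ((Nat.choose (p + 5) 2 : ℕ) : ℤ) + ((p : ℤ) + 4) ^ 2
      ≤ ((Nat.choose (p + e + 7) (e + 4) : ℕ) : ℤ) + 1 := by
    exact_mod_cast k'
  linarith

/-- The `TOP` bound is tight exactly at `(k′, d) = (4, 4)`: `C(5,2) = 10 = C(7,4) - C(5,2) - 16 + 1`. -/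
theorem top_tight_44 :
    ((Nat.choose (4 + 4 - 3) (4 - 2) : ℕ) : ℤ) = ((Nat.choose (4 + 4 - 1) 4 : ℕ) : ℤ) - ((Nat.choose (4 + 1) 2 : ℕ) : ℤ) - (4 : ℤ) ^ 2 + 1 := by
  decide

/-- `P = Q_1` (`φ = k′`) is admissible iff `(k′, d) ≠ (4, 4)` (`k′ = p + 4`, `d = e + 4`):
`BASE_Q(k′-1) + k′ ≤ 1`, i.e. `(p+3)² + C(p+4,2) - C(p+e+6, e+4) + (p+4) ≤ 1`, iff `¬(p = 0 ∧ e = 0)`. -/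
theorem P_admissible_iff (p e : ℕ) :
    ((p : ℤ) + 3) ^ 2 + ((Nat.choose (p + 4) 2 : ℕ) : ℤ) - ((Nat.choose (p + e + 6) (e + 4) : ℕ) : ℤ) + ((p : ℤ) + 4) ≤ 1
      ↔ ¬ (p = 0 ∧ e = 0) := by
  constructor
  · rintro h ⟨rfl, rfl⟩
    revert h
    decide
  · intro hne
    have grow3 : ∀ q : ℕ, 3 * q + 12 ≤ Nat.choose (q + 6) 3 := by
      intro q
      induction q with
      | zero => decide
      | succ q ih =>
        rw [show q + 1 + 6 = q + 7 from rfl]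
        have pas : Nat.choose (q + 7) 3 = Nat.choose (q + 6) 2 + Nat.choose (q + 6) 3 := by
          rw [show q + 7 = (q + 6) + 1 by ring, Nat.choose_succ_succ]
        have m2 : Nat.choose 6 2 ≤ Nat.choose (q + 6) 2 := Nat.choose_mono 2 (by omega)
        have c62 : Nat.choose 6 2 = 15 := by decide
        omega
    -- (A) all p, used for e ≥ 1:  (q+3)² + C(q+4,2) + q + 3 ≤ C(q+7, 5)
    have keyA : ∀ q : ℕ, (q + 3) ^ 2 + Nat.choose (q + 4) 2 + q + 3 ≤ Nat.choose (q + 7) 5 := by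
      intro q
      induction q with
      | zero => decide
      | succ q ih =>
        rw [show q + 1 + 3 = q + 4 from rfl, show q + 1 + 4 = q + 5 from rfl, show q + 1 + 7 = q + 8 from rfl]
        have q1 : Nat.choose (q + 8) 5 = Nat.choose (q + 7) 4 + Nat.choose (q + 7) 5 := by
          rw [show q + 8 = (q + 7) + 1 by ring, Nat.choose_succ_succ]
        have q2 : Nat.choose (q + 5) 2 = (q + 4) + Nat.choose (q + 4) 2 := by
          rw [show q + 5 = (q + 4) + 1 by ring, Nat.choose_succ_succ, Nat.choose_one_right]
        have q3 : Nat.choose (q + 7) 4 = Nat.choose (q + 6) 3 + Nat.choose (q + 6) 4 := by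
          rw [show q + 7 = (q + 6) + 1 by ring, Nat.choose_succ_succ]
        have sq : (q + 4) ^ 2 = (q + 3) ^ 2 + 2 * q + 7 := by ring
        have g := grow3 q
        omega
    -- (B) e = 0, p = q + 1 ≥ 1:  (q+4)² + C(q+5,2) + q + 4 ≤ C(q+7, 4)
    have keyB : ∀ q : ℕ, (q + 4) ^ 2 + Nat.choose (q + 5) 2 + q + 4 ≤ Nat.choose (q + 7) 4 := by
      intro q
      induction q with
      | zero => decide
      | succ q ih =>
        rw [show q + 1 + 4 = q + 5 from rfl, show q + 1 + 5 = q + 6 from rfl, show q + 1 + 7 = q + 8 from rfl]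
        have r1 : Nat.choose (q + 8) 4 = Nat.choose (q + 7) 3 + Nat.choose (q + 7) 4 := by
          rw [show q + 8 = (q + 7) + 1 by ring, Nat.choose_succ_succ]
        have r2 : Nat.choose (q + 6) 2 = (q + 5) + Nat.choose (q + 5) 2 := by
          rw [show q + 6 = (q + 5) + 1 by ring, Nat.choose_succ_succ, Nat.choose_one_right]
        have sq : (q + 5) ^ 2 = (q + 4) ^ 2 + 2 * q + 9 := by ring
        have g := grow3 (q + 1)
        rw [show q + 1 + 6 = q + 7 from rfl] at g
        omega
    have k' : (p + 3) ^ 2 + Nat.choose (p + 4) 2 + p + 3 ≤ Nat.choose (p + e + 6) (e + 4) := by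
      rcases Nat.eq_zero_or_pos e with he | he
      · subst he
        rcases Nat.eq_zero_or_pos p with hp | hp
        · exact absurd ⟨hp, rfl⟩ hne
        · obtain ⟨q, rfl⟩ : ∃ q, p = q + 1 := ⟨p - 1, by omega⟩
          rw [show q + 1 + 3 = q + 4 from rfl, show q + 1 + 4 = q + 5 from rfl, show q + 1 + 0 + 6 = q + 7 from rfl,
            show (0 : ℕ) + 4 = 4 from rfl]
          have k := keyB q
          omega
      · have mono : Nat.choose (p + 7) 5 ≤ Nat.choose (p + e + 6) (e + 4) := by
          have s1 : Nat.choose (p + e + 6) (e + 4) = Nat.choose ((p + 2) + (e + 4)) (p + 2) := by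
            rw [show p + e + 6 = (p + 2) + (e + 4) by ring, Nat.choose_symm_add]
          have s2 : Nat.choose (p + 7) 5 = Nat.choose ((p + 2) + 5) (p + 2) := by
            rw [show p + 7 = (p + 2) + 5 by ring, Nat.choose_symm_add]
          rw [s1, s2]; exact Nat.choose_mono (p + 2) (by omega)
        exact le_trans (keyA p) mono
    have kz : ((p : ℤ) + 3) ^ 2 + ((Nat.choose (p + 4) 2 : ℕ) : ℤ) + (p : ℤ) + 3 ≤ ((Nat.choose (p + e + 6) (e + 4) : ℕ) : ℤ) := by
      exact_mod_cast k'
    linarith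

/-- `G_2` at `d = 4` (`φ = 2`) is admissible iff `k′ ≥ 6` (`k′ = p + 4`, `m = k′ - 2 = p + 2`):
`BASE_G(m) + 2 ≤ 1` with `BASE_G(m) = m² + C(m+d-3, d-2) - C(m+d-1, d)` at `d = 4`, iff `2 ≤ p`. -/
theorem G2_d4_admissible_iff (p : ℕ) :
    ((p : ℤ) + 2) ^ 2 + ((Nat.choose ((p + 2) + 4 - 3) (4 - 2) : ℕ) : ℤ) - ((Nat.choose ((p + 2) + 4 - 1) 4 : ℕ) : ℤ) + 2 ≤ 1
      ↔ 2 ≤ p := by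
  have a1 : (p + 2) + 4 - 3 = p + 3 := by omega
  have a2 : (4 : ℕ) - 2 = 2 := by norm_num
  have a3 : (p + 2) + 4 - 1 = p + 5 := by omega
  rw [a1, a2, a3]
  constructor
  · intro h
    by_contra hp
    have hp' : p < 2 := Nat.lt_of_not_le hp
    interval_cases p <;> revert h <;> decide
  · intro hp
    obtain ⟨q, rfl⟩ : ∃ q, p = q + 2 := ⟨p - 2, by omega⟩
    have grow3 : ∀ q : ℕ, 3 * q + 12 ≤ Nat.choose (q + 6) 3 := by
      intro q
      induction q with
      | zero => decide
      | succ q ih =>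
        rw [show q + 1 + 6 = q + 7 from rfl]
        have pas : Nat.choose (q + 7) 3 = Nat.choose (q + 6) 2 + Nat.choose (q + 6) 3 := by
          rw [show q + 7 = (q + 6) + 1 by ring, Nat.choose_succ_succ]
        have m2 : Nat.choose 6 2 ≤ Nat.choose (q + 6) 2 := Nat.choose_mono 2 (by omega)
        have c62 : Nat.choose 6 2 = 15 := by decide
        omega
    have key : ∀ q : ℕ, (q + 4) ^ 2 + Nat.choose (q + 5) 2 + 1 ≤ Nat.choose (q + 7) 4 := by
      intro q
      induction q with
      | zero => decide
      | succ q ih =>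
        rw [show q + 1 + 4 = q + 5 from rfl, show q + 1 + 5 = q + 6 from rfl, show q + 1 + 7 = q + 8 from rfl]
        have r1 : Nat.choose (q + 8) 4 = Nat.choose (q + 7) 3 + Nat.choose (q + 7) 4 := by
          rw [show q + 8 = (q + 7) + 1 by ring, Nat.choose_succ_succ]
        have r2 : Nat.choose (q + 6) 2 = (q + 5) + Nat.choose (q + 5) 2 := by
          rw [show q + 6 = (q + 5) + 1 by ring, Nat.choose_succ_succ, Nat.choose_one_right]
        have sq : (q + 5) ^ 2 = (q + 4) ^ 2 + 2 * q + 9 := by ring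
        have g := grow3 (q + 1)
        rw [show q + 1 + 6 = q + 7 from rfl] at g
        omega
    rw [show q + 2 + 3 = q + 5 from rfl, show q + 2 + 5 = q + 7 from rfl]
    have hsq : ((↑(q + 2) : ℤ) + 2) = (q : ℤ) + 4 := by push_cast; ring
    rw [hsq]
    have kz : ((q : ℤ) + 4) ^ 2 + ((Nat.choose (q + 5) 2 : ℕ) : ℤ) + 1 ≤ ((Nat.choose (q + 7) 4 : ℕ) : ℤ) := by
      exact_mod_cast key q
    linarith

end Summit.HodgeConjecture.HodgeConjecture.HodgeLocus.Census.JumpArithmetic
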